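import Summits.AnomalousDissipation.AnomalousDissipation.Theorems.MarginalStabilityChainStrainedLayerLawClockMeanDissipationFaces
import HarnessLib

/-!
# Crux `MarginalStabilityChain.StrainedLayerLaw` (stmt-AnomalousDissipation-3007), line `FirstLemmasR2K4`
# (log-enstrophy clock + Nash roundness): the crux ⇐ hygiene + ENSTROPHY MEAN FLOOR (kernel-checked reduction)

Support file (`--supports stmt-AnomalousDissipation-3007`; registered sub-goal `StrainedLayerLaw_of_enstrophyMeanFloor`
of line `FirstLemmasR2K4`, lead c7). The line's open dynamical stub (eventual Nash roundness, B3) is SUFFICIENT for the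
crux (`StrainedLayerLaw_of_roundnessFloor`); the WEAKEST dynamical statement that suffices — and, member by member, is
also necessary (neighbour stub `enstrophyMeanFloor_of_meanLayerDissipation`) — is the ENSTROPHY MEAN FLOOR:

  (hF) `∃ c > 0 ∀ L > 0 ∃ ν₀ > 0 ∃ θ` admissible `∀ ν ∈ (0, ν₀]`, for every finite-dissipation tailed member of the class
       from `U_B^ν + θ` and every `ε > 0`: eventually in `T`, `(c·min(L,1)·L − ε) T ≤ ν ∫_1^T Ω(τ) dτ`,
       `Ω(τ) = ∫_{x ∈ (0,L]} ∫_y ω(τ)²` (iterated form).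

This file kernel-checks "hygiene (h3) + (hF) ⇒ `StrainedLayerLaw`" with the SAME constant `c`. Proof: the pattern of
`StrainedLayerLaw_of_clockStubs` (`…ClockComposition.lean`) without the clock: unfold the crux to
`InCruxClass … → ofReal (c·min(L,1)) ≤ meanLayerDissipation ν L u v`, apply the abstract Cesàro lemma
`floorTransfer_direct` (`…ClockLine.lean`) with `K = c·min(L,1)`; under local finiteness (h3) gives tails, (hF) gives the
real floor, and the ENSTROPHY FACE `faces_enstrophy` (`…MeanDissipationFaces.lean`: `L·(∫⁻_{(1,T]} D).toReal = ν∫_1^T Ω`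
for `T > 1`) together with the finiteness of the window lintegral (`≤ ∫⁻_{(0,T]} D < ∞`) converts it into the `ℝ≥0∞`
floor `ofReal ((L·K − ε)T) ≤ ofReal L · ∫⁻_{(1,T]} D`. No facts are asserted (the theorem is a reduction: it concludes
the crux BY NAME under the two hypotheses).
-/

-- `Summit.<Summit>.<Problem>` is the tree's mandated summit-side namespace (CONVENTIONS §2); for this
-- single-conjunct summit the two coincide, so the duplicate is deliberate.
set_option linter.dupNamespace false

noncomputable section

open scoped Topology ENNReal
open Filter Set Function MeasureTheory

namespace Summit.AnomalousDissipation.AnomalousDissipation.Theorems.StrainedLayerLaw.LogEnstrophyClock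

open Literature.Analysis.FluidPDE Literature.Analysis.FluidPDE.StretchedLayer
open Summit.AnomalousDissipation.AnomalousDissipation.Theses.MarginalStabilityChain
open Summit.AnomalousDissipation.AnomalousDissipation.Theorems.StrainedLayerLaw.StrainWorkSumRule

/-- **One member: the real enstrophy floor on a window is the `ℝ≥0∞` dissipation floor.** For a tailed classical
solution with locally finite dissipation, `T > 1` and any real `a ≤ ν ∫_1^T Ω`:
`ofReal a ≤ ofReal L · ∫⁻_{(1,T]} D` (enstrophy face `faces_enstrophy` + `ofReal_toReal` on the finite window lintegral).
[folklore] -/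
theorem enstrophyMeanFloor_ofReal_le_window {ν L : ℝ} (hν : 0 < ν) (hL : 0 < L) {u v p : ℝ → ℝ → ℝ → ℝ}
    (hsol : IsStretchedLayerNSSolutionOn (Ioi 0) ν 1 1 L u v p)
    (htails : ∀ a b : ℝ, 0 < a → a < b → ExpTails (Icc a b) u v)
    (hfin : ∀ T : ℝ, 0 < T → ∫⁻ t in Ioc 0 T, layerDissipation ν L (u t) (v t) ≠ ∞)
    {T a : ℝ} (hT : 1 < T)
    (ha : a ≤ ν * ∫ τ in (1:ℝ)..T, (∫ x in Ioc 0 L, ∫ y, vorticity (u τ) (v τ) x y ^ 2)) :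
    ENNReal.ofReal a ≤ ENNReal.ofReal L * ∫⁻ t in Ioc 1 T, layerDissipation ν L (u t) (v t) := by
  have hface := faces_enstrophy hν hL hsol htails hT
  -- the window lintegral is finite: `(1, T] ⊆ (0, T]`
  have hfinw : ∫⁻ t in Ioc 1 T, layerDissipation ν L (u t) (v t) ≠ ∞ :=
    ne_top_of_le_ne_top (hfin T (one_pos.trans hT)) (lintegral_mono_set (Ioc_subset_Ioc_left zero_le_one))
  calc ENNReal.ofReal a
      ≤ ENNReal.ofReal (ν * ∫ τ in (1:ℝ)..T, (∫ x in Ioc 0 L, ∫ y, vorticity (u τ) (v τ) x y ^ 2)) :=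
        ENNReal.ofReal_le_ofReal ha
    _ = ENNReal.ofReal (L * (∫⁻ t in Ioc 1 T, layerDissipation ν L (u t) (v t)).toReal) := by rw [hface]
    _ = ENNReal.ofReal L * ∫⁻ t in Ioc 1 T, layerDissipation ν L (u t) (v t) := by
        rw [ENNReal.ofReal_mul hL.le, ENNReal.ofReal_toReal hfinw]

/-- **The crux ⇐ hygiene + enstrophy mean floor (kernel-checked reduction, registered sub-goal
`StrainedLayerLaw_of_enstrophyMeanFloor`).** Hypotheses: (h3) hygiene — finite-dissipation members of the bare class
have shear tails on compact time intervals (the sum-rule line's `stub_bareClassTails`, same signature); (hF) the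
ENSTROPHY MEAN FLOOR — one admissible `θ` per period such that for all small `ν` every finite-dissipation, tailed member
of the class from `U_B^ν + θ` satisfies, for every `ε > 0`, eventually `(c·min(L,1)·L − ε)T ≤ ν∫_1^T Ω`. Conclusion:
`StrainedLayerLaw` with the same `c`: take `ν₀, θ` from (hF); for a class member apply `floorTransfer_direct` with
`K = c·min(L,1)`; under local finiteness (h3) gives tails, (hF) the real floor, and `enstrophyMeanFloor_ofReal_le_window`
(the enstrophy face) turns it into `ofReal ((L·K − ε)T) ≤ ofReal L · ∫⁻_{(1,T]} D`. [folklore] -/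
theorem StrainedLayerLaw_of_enstrophyMeanFloor (h3 : ∀ (ν L : ℝ), 0 < ν → 0 < L → ∀ (θ₁ θ₂ : ℝ → ℝ → ℝ), IsAdmissible L θ₁ θ₂ → ∀ (u v p : ℝ → ℝ → ℝ → ℝ), InCruxClass ν L θ₁ θ₂ u v p → (∀ T : ℝ, 0 < T → ∫⁻ t in Ioc 0 T, layerDissipation ν L (u t) (v t) ≠ ∞) → ∀ a b : ℝ, 0 < a → a < b → ExpTails (Icc a b) u v) (hF : ∃ c : ℝ, 0 < c ∧ ∀ L : ℝ, 0 < L → ∃ ν₀ : ℝ, 0 < ν₀ ∧ ∃ θ₁ θ₂ : ℝ → ℝ → ℝ, IsAdmissible L θ₁ θ₂ ∧ ∀ ν : ℝ, 0 < ν → ν ≤ ν₀ → ∀ (u v p : ℝ → ℝ → ℝ → ℝ), InCruxClass ν L θ₁ θ₂ u v p → (∀ T : ℝ, 0 < T → ∫⁻ t in Ioc 0 T, layerDissipation ν L (u t) (v t) ≠ ∞) → (∀ a b : ℝ, 0 < a → a < b → ExpTails (Icc a b) u v) → ∀ ε : ℝ, 0 < ε → ∀ᶠ T : ℝ in atTop,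 (c * min L 1 * L - ε) * T ≤ ν * ∫ τ in (1:ℝ)..T, (∫ x in Ioc 0 L, ∫ y, vorticity (u τ) (v τ) x y ^ 2)) : StrainedLayerLaw := by
  obtain ⟨c, hc, hfloor⟩ := hF
  refine ⟨c, hc, ?_⟩
  intro L hL
  obtain ⟨ν₀, hν₀, θ₁, θ₂, hθ, hmain⟩ := hfloor L hL
  refine ⟨ν₀, hν₀, θ₁, θ₂, hθ.1, hθ.2.1, hθ.2.2.1, hθ.2.2.2.1, hθ.2.2.2.2, ?_⟩
  intro ν hν hνle u v p
  show InCruxClass ν L θ₁ θ₂ u v p → ENNReal.ofReal (c * min L 1) ≤ meanLayerDissipation ν L u v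
  intro hcl
  have hsol : IsStretchedLayerNSSolutionOn (Ioi 0) ν 1 1 L u v p := hcl.isSolution
  refine floorTransfer_direct L (c * min L 1) (fun t => layerDissipation ν L (u t) (v t)) hL ?_
  intro hfin ε hε
  have htails : ∀ a b : ℝ, 0 < a → a < b → ExpTails (Icc a b) u v :=
    h3 ν L hν hL θ₁ θ₂ hθ u v p hcl hfin
  have hfl := hmain ν hν hνle u v p hcl hfin htails ε hε
  filter_upwards [hfl, eventually_gt_atTop 1] with T hT hT1
  refine enstrophyMeanFloor_ofReal_le_window hν hL hsol htails hfin hT1 ?_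
  have hKL : L * (c * min L 1) = c * min L 1 * L := by ring
  rw [hKL]
  exact hT

end Summit.AnomalousDissipation.AnomalousDissipation.Theorems.StrainedLayerLaw.LogEnstrophyClock

end
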